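import Summits.NavierStokesRegularity.NavierStokesRegularity.Theses.QuantisedSymmetry
import Summits.NavierStokesRegularity.NavierStokesRegularity.Theorems.QuantisedSymmetryPolyhedralTruncationBridge
import Summits.NavierStokesRegularity.NavierStokesRegularity.Theorems.QuantisedSymmetryLiouvilleKillsProfile

/-!
# Strategist sketch s18-g2 — crux `PolyhedralDssProfileExists` (stmt-NavierStokesRegularity-1404)

Typed companion of `STRATEGY-CENSUS-s18.md` (family `s`, generation 2, independent census) for
route-NavierStokesRegularity-QuantisedSymmetry.  Nothing here restates or weakens the crux; the
file records, kernel-checked: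

* `crux_decides_summit` — §0 of the census: the crux ALONE proves `¬ NavierStokesRegularity`
  from tree theorems (`closes` with both other binders discharged by landed proofs), so every
  replacement that still closes this route is at least summit-strength (negative side);
* `WeakPolyhedralTypeIAncient` / `weak_of_crux` — the only strictly weaker off-path
  intermediate found (= `¬ PolyhedralTypeILiouville`, item #3 negated), with `C → W′` proved;
* `RecurrenceRigidity` / `crux_of_split` — the typed surrogate of the best honest split
  `W′ ∧ R ⇒ C` (trivial seam; see census §2 for why both halves are planless);
* `nsRescaleForce_fixed_bounded_eq_zero` — the lemma behind census §1(B): a bounded force that is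
  covariant under one DSS rescaling with factor `c > 1` vanishes identically, so "forced Type-I
  DSS blow-up" carries exactly the unforced profile content.
-/

namespace Summit.NavierStokesRegularity.NavierStokesRegularity.Cruxes.PolyhedralDssProfileExists.S18g2

open Summit.NavierStokesRegularity.NavierStokesRegularity.Theses.QuantisedSymmetry

/-- §0 (load-bearing fact of the verdict): the crux alone decides the summit, negatively, by
tree theorems: `closes` + `quantisedSymmetry_polyhedralTruncationBridge_proof` (hB) +
`ClayUniqueness_holds` (hU). -/
theorem crux_decides_summit (h : PolyhedralDssProfileExists) : ¬ _root_.NavierStokesRegularity :=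
  closes h
    _root_.Summit.NavierStokesRegularity.NavierStokesRegularity.Theorems.quantisedSymmetry_polyhedralTruncationBridge_proof
    ClayUniqueness_holds

/-- W′ — the off-path strictly weaker intermediate: a nontrivial `G`-equivariant (finite
irreducible proper rotation group) Type-I-decaying bounded ancient mild solution exists,
i.e. the negation of the route's kill switch `PolyhedralTypeILiouville` (item #3). -/
def WeakPolyhedralTypeIAncient : Prop := ¬ PolyhedralTypeILiouville

/-- `C → W′` (tree: `LiouvilleKillsProfile` is proved). -/
theorem weak_of_crux (h : PolyhedralDssProfileExists) : WeakPolyhedralTypeIAncient :=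
  fun hL =>
    _root_.Summit.NavierStokesRegularity.NavierStokesRegularity.Theorems.quantisedSymmetry_liouvilleKillsProfile_proof
      hL h

/-- R — typed SURROGATE of the recurrence-rigidity half of the split `W′ ∧ R ⇒ C` (census §2,
D-F): "every minimal set of the scaling flow on the compact class of singular `G`-equivariant
Type-I ancient solutions is a closed orbit".  Over existing declarations only the bare
implication can be typed (the scaling flow on that class is not a tree object); the seam of the
split is therefore trivial and flagged as such in the census. -/
def RecurrenceRigidity : Prop := WeakPolyhedralTypeIAncient → PolyhedralDssProfileExists

/-- Assembly of the split (trivial seam). -/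
theorem crux_of_split (hW : WeakPolyhedralTypeIAncient) (hR : RecurrenceRigidity) :
    PolyhedralDssProfileExists :=
  hR hW

/-- Census §1(B): a force field fixed by ONE Navier–Stokes force rescaling
`f ↦ c³ f(c²t, cx)` with `1 < c` and bounded on all of space–time is identically zero
(iterate the covariance towards small scales: `‖f(t,x)‖ ≤ M / c^{3n}` for every `n`).  Hence a
`c`-DSS blow-up driven by a bounded DSS-covariant force is an unforced one. -/
theorem nsRescaleForce_fixed_bounded_eq_zero {E : Type*} [NormedAddCommGroup E] [NormedSpace ℝ E]
    {F : Type*} [NormedAddCommGroup F] [NormedSpace ℝ F]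
    {c M : ℝ} (hc : 1 < c) (f : ℝ → E → F)
    (hb : ∀ t x, ‖f t x‖ ≤ M)
    (hcov : Literature.Analysis.FluidPDE.nsRescaleForce c f = f) (t : ℝ) (x : E) :
    f t x = 0 := by
  have hc0 : 0 < c := lt_trans zero_lt_one hc
  have hcne : c ≠ 0 := hc0.ne'
  have hc3 : 0 < c ^ 3 := by positivity
  have hcov' : ∀ t x, f t x = c ^ 3 • f (c ^ 2 * t) (c • x) := by
    intro t x
    have := congrArg (fun g => g t x) hcov
    simpa [Literature.Analysis.FluidPDE.nsRescaleForce] using this.symm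
  have key : ∀ n : ℕ, ∀ t x, ‖f t x‖ ≤ M / (c ^ 3) ^ n := by
    intro n
    induction n with
    | zero => intro t x; simpa using hb t x
    | succ n ih =>
      intro t x
      have h1 := hcov' (t / c ^ 2) (c⁻¹ • x)
      have hct : c ^ 2 * (t / c ^ 2) = t := by field_simp
      have hcx : c • (c⁻¹ • x) = x := by rw [smul_smul, mul_inv_cancel₀ hcne, one_smul]
      rw [hct, hcx] at h1
      have h2 : ‖f (t / c ^ 2) (c⁻¹ • x)‖ = c ^ 3 * ‖f t x‖ := by
        rw [h1, norm_smul, Real.norm_eq_abs, abs_of_pos hc3]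
      have h3 := ih (t / c ^ 2) (c⁻¹ • x)
      rw [h2] at h3
      rw [pow_succ, ← div_div, le_div_iff₀ hc3, mul_comm]
      exact h3
  have hlim : Filter.Tendsto (fun n : ℕ => M / (c ^ 3) ^ n) Filter.atTop (nhds 0) :=
    tendsto_const_nhds.div_atTop (tendsto_pow_atTop_atTop_of_one_lt (one_lt_pow₀ hc three_ne_zero))
  have h0 : ‖f t x‖ ≤ 0 := ge_of_tendsto' hlim (fun n => key n t x)
  exact norm_le_zero_iff.mp h0

end Summit.NavierStokesRegularity.NavierStokesRegularity.Cruxes.PolyhedralDssProfileExists.S18g2
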